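import Summits.BirchSwinnertonDyer.Rank1Residual.X11b.BDPRouteSelmerLevelBound
import Summits.BirchSwinnertonDyer.Rank1Residual.X11b.BDPRouteLevelToKummerTorsion
import Summits.BirchSwinnertonDyer.Rank1Residual.X11b.BDPRouteStrictAtPlaceTorsion
import HarnessLib

/-!
# X11b, route p2 — THE LEVEL BOUND for Castella's `Sel_𝔭(K, E[p^∞])` WITHOUT (iv):
# `#H¹_{𝓛^{(k)}}(K, E[p^k]) ≤ [E(K_𝔭):p^kE(K_𝔭)+imE(K)] · #Ш[p^∞] · [E(K_𝔭):T+p^kE(K_𝔭)+imE(K)]`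
# when `[E(K_𝔭) : T + p^kE(K_𝔭)] = [E(K) : p^kE(K)]`, `T` the torsion of `E(K_𝔭)`
# (cell `b2b-bsdres`, sub-cell `multr1-p2`, gen 17)

HONEST FRAMING (cell `b2b-bsdres`, run/shared/lean/b2b/bsd-rank1-residual/, verbatim in every
file): the goal of the cell is to DELETE the COMBINATION-SHAPED residual classes of the
Birch–Swinnerton-Dyer formula for ALL analytic-rank `≤ 1` elliptic curves over `ℚ` — "full BSD
formula for every rank `≤ 1` curve in class `C`" assembled STRICTLY from published theorems — so
that the rank-`≤ 1` remainder becomes exactly the CONSTRUCTION-SHAPED classes, which are TYPED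
(missing-input `Prop`s), NOT attempted. This is not "finishing BSD". Sub-cell
`b2b-bsdres-multr1-p2` (X11b, route p2 = BDP + converse + Kolyvagin); a RESEARCH ROUTE; no claim
beyond the stated class; X11b stays CONSTRUCTION-SHAPED; nothing here changes a label; no named
fact is minted (theorems only; no `sorry`). Continues `BDPRouteSelmerLevelBound` (gen 16).

## What is here

Gen 16's level bound `natCard_level_le_of_indices` needs `E[p^∞](K̄)^{Γ_{K_𝔭}} = 0` (the erratum's
(iv)). Here the SAME chain without it — glue with the torsion-valued condition at `𝔭`
(`LevelKummer.finite_and_natCard_selmerGroup_acLevelStructure_le_torsion`), `#(A ∩ C) ≤ [A:S]·#(S ∩ C)`,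
Part B at `𝔮` + the `𝔭 ↔ 𝔮` symmetry, Part A with the torsion-valued condition
(`StrictAtPlace.natCard_selmerGroup_inf_comap_mul_index_le`):

* **`natCard_level_le_of_indices_torsion`** — for `k ≥ 1`, `𝔭 ≠ 𝔮 = σ • 𝔭` the places above `p`,
  `T` the torsion subgroup of `E(K_𝔭)`: if `[E(K_𝔭) : p^kE(K_𝔭) + im E(K)] = L₁`,
  `[E(K_𝔭) : T + p^kE(K_𝔭)] = M = [E(K) : p^kE(K)] ≠ 0`,
  `[E(K_𝔭) : (T + p^kE(K_𝔭)) + im E(K)] = L₂` and `#Ш(E/K)[p^k] ≤ S`, then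
  `#H¹_{𝓛^{(k)}}(K, E[p^k]) ≤ L₁ · (S · L₂)` — from Poitou–Tate and the local Euler characteristic
  at `K_𝔮`, NO hypothesis on `E(K_𝔭)[p]`.

This is JSW17 Prop. 3.2.1 (`≤`) / Cas18 (3.2.1)+(calcul) at finite level with the
`#H⁰(K_𝔭, E[p^∞])`-factor carried by `L₂` (`= p^{min(k, e − m)}`, `p^m = #E(ℚ_p)[p^∞]`,
`ZpLineIndexTorsion`). Nothing booked; labels unchanged.

References: [JetchevSkinnerWan2017] Prop. 3.2.1 (arXiv:1512.06894 pp. 10–11); [Castella2018]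
(3.2.1) and (calcul) (arXiv:1704.06608 pp. 5–6); [MilneADT2006] I Thm. 2.8, Thm. 4.10(b), Lemma 6.15.
-/

noncomputable section

open scoped Classical

universe u

namespace Summit.BirchSwinnertonDyer.Rank1Residual.X11b.SelmerLevelBound

open WeierstrassCurve NumberField IsDedekindDomain Field Function
open Literature.NumberTheory.EllipticCurves Literature.NumberTheory.EllipticCurves.GreenbergSelmer
open Literature.NumberTheory.GaloisRepresentations Literature.NumberTheory.GaloisCohomology
open Summit.BirchSwinnertonDyer.Rank1Residual.X11b.AcSelmer
open Summit.BirchSwinnertonDyer.Rank1Residual.X11b.LocBridge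

variable (W : WeierstrassCurve ℚ) [W.IsElliptic] (K : Type) [Field K] [NumberField K]
  (p k : ℕ) [Fact p.Prime] (𝔭 𝔮 : HeightOneSpectrum (𝓞 K))

/-- **THE LEVEL BOUND WITHOUT (iv) (JSW17 Prop. 3.2.1 `≤` at level `p^k`, indices symbolic).** Let
`k ≥ 1`, `𝔭 ≠ 𝔮 = σ • 𝔭` with every place above `p` equal to `𝔭` or `𝔮`, and `T` the torsion
subgroup of `E(K_𝔭)`. If `[E(K_𝔭) : p^kE(K_𝔭) + im E(K)] = L₁`, `[E(K_𝔭) : T + p^kE(K_𝔭)] = M`,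
`[E(K) : p^kE(K)] = M ≠ 0`, `[E(K_𝔭) : (T + p^kE(K_𝔭)) + im E(K)] = L₂` and `#Ш(E/K)[p^k] ≤ S`, then
Castella's level-`k` group satisfies `#H¹_{𝓛^{(k)}}(K, E[p^k]) ≤ L₁ · (S · L₂)` — from the two
textbook facts (Poitou–Tate, local Euler characteristic at `K_𝔮`), NO hypothesis on `E(K_𝔭)[p]`.
[cite: JetchevSkinnerWan2017, Prop. 3.2.1 (proof, arXiv:1512.06894 pp. 10–11)]
[cite: Castella2018, proof of Thm. 2.3, (3.2.1) and (calcul) (arXiv:1704.06608 pp. 5–6)]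
[cite: MilneADT2006, Ch. I, Thm. 4.10(b) and Thm. 2.8] -/
theorem natCard_level_le_of_indices_torsion (hk : 0 < k) (σ : K ≃ₐ[ℚ] K) (hσ : σ • 𝔭 = 𝔮)
    (h𝔮 : ∀ v : HeightOneSpectrum (𝓞 K), v ≠ 𝔭 → ((p : ℕ) : 𝓞 K) ∈ v.asIdeal → v = 𝔮)
    (hPT : poitouTate_sum_localTatePairing_eq_zero K)
    (hEP : localEulerPoincareCharacteristic (𝔮.adicCompletion K))
    {L₁ L₂ M S : ℕ}
    (hL₁ : ((Affine.Point.baseChange (W' := W.baseChange K) K (𝔭.adicCompletion K)).range ⊔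
        (zsmulAddGroupHom ((p ^ k : ℕ) : ℤ) :
          ((W.baseChange K).baseChange (𝔭.adicCompletion K)).toAffine.Point →+ _).range).index = L₁)
    (hM : (AddCommGroup.torsion ((W.baseChange K).baseChange (𝔭.adicCompletion K)).toAffine.Point ⊔
        (zsmulAddGroupHom ((p ^ k : ℕ) : ℤ) :
          ((W.baseChange K).baseChange (𝔭.adicCompletion K)).toAffine.Point →+ _).range).index = M)
    (hM0 : M ≠ 0)
    (hN : ((zsmulAddGroupHom ((p ^ k : ℕ) : ℤ) : (W.baseChange K).toAffine.Point →+ _).range).index = M)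
    (hL₂ : ((Affine.Point.baseChange (W' := W.baseChange K) K (𝔭.adicCompletion K)).range ⊔
        (AddCommGroup.torsion ((W.baseChange K).baseChange (𝔭.adicCompletion K)).toAffine.Point ⊔
          (zsmulAddGroupHom ((p ^ k : ℕ) : ℤ) :
            ((W.baseChange K).baseChange (𝔭.adicCompletion K)).toAffine.Point →+ _).range)).index = L₂)
    (hS : Nat.card ↥((W.baseChange K).sha ⊓
        AddSubgroup.torsionBy (W.baseChange K).galH1 ((p ^ k : ℕ) : ℤ)) ≤ S) :
    Finite (acLevelStructure (W.baseChange K) p k 𝔭 ∅).selmerGroup ∧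
      Nat.card (acLevelStructure (W.baseChange K) p k 𝔭 ∅).selmerGroup ≤ L₁ * (S * L₂) := by
  haveI hEK : (W.baseChange K).IsElliptic := by rw [baseChange]; infer_instance
  haveI : NeZero (p ^ k) := ⟨pow_ne_zero _ (Fact.out : p.Prime).ne_zero⟩
  haveI : CharZero (𝔭.adicCompletion K) := charZero_adicCompletion 𝔭
  have hnZ : ((p ^ k : ℕ) : ℤ) ≠ 0 := Int.natCast_ne_zero.mpr (NeZero.ne _)
  set E := W.baseChange K with hE
  set n : ℕ := p ^ k with hn
  set Sel := selmerGroup E (n : ℤ) with hSel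
  set KO := kummerOutside E n {Sum.inr 𝔮} with hKO
  set C := ((AddCommGroup.torsion (E.baseChange (𝔭.adicCompletion K)).toAffine.Point).map
      (E.localKummerMap (𝔭.adicCompletion K) hnZ)).comap
    (galoisCohomology.res (E.torsionGaloisModule (n : ℤ)) (𝔭.adicCompletion K) 1) with hC
  -- (1) glue, torsion-valued condition at `𝔭`
  have hT : ∀ v : HeightOneSpectrum (𝓞 K), v ≠ 𝔭 →
      (((p : ℕ) : 𝓞 K) ∈ v.asIdeal ∨ v ∈ (∅ : Set (HeightOneSpectrum (𝓞 K)))) →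
        (Sum.inr v : Place K) ∈ ({Sum.inr 𝔮} : Finset (Place K)) := by
    rintro v hv (hpv | hv0)
    · rw [h𝔮 v hv hpv, Finset.mem_singleton]
    · exact absurd hv0 (Set.notMem_empty v)
  haveI hKOfin : Finite KO := finite_kummerOutside E n {Sum.inr 𝔮}
  haveI : Finite ↥(KO ⊓ C) := Finite.of_injective _ (AddSubgroup.inclusion_injective inf_le_left)
  haveI : Finite ↥(kummerOutside E (p ^ k) {Sum.inr 𝔮} ⊓
      ((AddCommGroup.torsion
          (E.baseChange (Place.Completion (Sum.inr 𝔭 : Place K))).toAffine.Point).map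
        (E.localKummerMap (Place.Completion (Sum.inr 𝔭 : Place K)) hnZ)).comap
        (galoisCohomology.localization (E.torsionGaloisModule ((p ^ k : ℕ) : ℤ)) (Sum.inr 𝔭) 1)) :=
    Finite.of_injective _ (AddSubgroup.inclusion_injective inf_le_left)
  obtain ⟨hfin, hglue⟩ :=
    LevelKummer.finite_and_natCard_selmerGroup_acLevelStructure_le_torsion E p k 𝔭 ∅ {Sum.inr 𝔮}
      hT hnZ
  refine ⟨hfin, hglue.trans ?_⟩
  change Nat.card ↥(KO ⊓ C) ≤ _
  -- (2) `#(KO ⊓ C) ≤ [KO : Sel] · #(Sel ⊓ C)`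
  have hSelKO : Sel ≤ KO := selmerGroup_le_kummerOutside E n _
  refine (natCard_inf_le_relIndex_mul KO Sel C hSelKO).trans ?_
  -- (3) Part B at `𝔮`, then the symmetry `𝔮 ↔ 𝔭`
  have hpp : IsPrimePow n := ⟨p, k, (Fact.out : p.Prime).prime, hk, rfl⟩
  have hB : Sel.relIndex KO ≤ L₁ := by
    have h := Relaxation.relIndex_selmerGroup_kummerOutside_le_of_facts E n 𝔮 hpp hPT hEP
    rw [← LocalIndexSymmetry.index_range_baseChange_sup_eq_of_algEquiv_smul W σ hσ (n : ℤ), hL₁] at h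
    exact h
  -- (4) Part A with the torsion-valued condition at `𝔭`
  have hA : Nat.card ↥(Sel ⊓ C) ≤ S * L₂ := by
    have hdiv := E.zsmul_geomPoints_surjective_holds hnZ
    have h := StrictAtPlace.natCard_selmerGroup_inf_comap_mul_index_le E (𝔭.adicCompletion K) hnZ
      hdiv (AddCommGroup.torsion (E.baseChange (𝔭.adicCompletion K)).toAffine.Point)
    change Nat.card ↥(Sel ⊓ C) * _ ≤ _ at h
    rw [hM, hN, hL₂] at h
    have h' : Nat.card ↥(Sel ⊓ C) * M ≤ (S * L₂) * M := by
      calc Nat.card ↥(Sel ⊓ C) * M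
          ≤ Nat.card ↥(E.sha ⊓ AddSubgroup.torsionBy E.galH1 (n : ℤ)) * (M * L₂) := h
        _ ≤ S * (M * L₂) := Nat.mul_le_mul_right _ hS
        _ = (S * L₂) * M := by ring
    exact Nat.le_of_mul_le_mul_right h' (Nat.pos_of_ne_zero hM0)
  calc Sel.relIndex KO * Nat.card ↥(Sel ⊓ C) ≤ L₁ * (S * L₂) := Nat.mul_le_mul hB hA

end Summit.BirchSwinnertonDyer.Rank1Residual.X11b.SelmerLevelBound

end
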